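import Summits.BirchSwinnertonDyer.Rank1Residual.X11b.Three.ControlIdentityOdd
import Summits.BirchSwinnertonDyer.Rank1Residual.X11b.Three.OpenInputTight
import Summits.BirchSwinnertonDyer.Rank1Residual.X11b.Three.StepLAtThree
import HarnessLib

/-!
# X11b at `p = 3` (team `x11b3`, N8/O2): THE open input ⟺ `BSD(E,p)` from published + cited facts
# ALONE on X11b ∧ (ram) ∧ `p ∤ ∏c` ∧ locally-trivial — the tightness theorem with its control
# hypothesis DISCHARGED (sub-target T2-CTL3, companion of `Three/ControlIdentityOdd`)

HONEST FRAMING (cell `b2b-bsdres`, run/shared/lean/b2b/bsd-rank1-residual/, verbatim in every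
file): the goal of the cell is to DELETE the COMBINATION-SHAPED residual classes of the
Birch–Swinnerton-Dyer formula for ALL analytic-rank `≤ 1` elliptic curves over `ℚ` — "full BSD
formula for every rank `≤ 1` curve in class `C`" assembled STRICTLY from published theorems — so
that the rank-`≤ 1` remainder becomes exactly the CONSTRUCTION-SHAPED classes, which are TYPED
(missing-input `Prop`s), NOT attempted. This is not "finishing BSD". Team `x11b3` (coordinator
ruling 2026-08-21T04:04Z; STEP L at `p = 3`, `3 ‖ N`, `r = 1`, `E[3]` irreducible) is a RESEARCH
ROUTE; no claim beyond the stated class and sub-population; X11 ∧ `r = 1` at `p = 3` stays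
CONSTRUCTION-SHAPED / OPEN (RESIDUAL-MAP §I O2); nothing here changes a label; THEOREMS ONLY (no
definition, no named fact, no `sorry`).

## What this file proves

Three team files meet here. `Three/OpenInputTight` (x11b3-p7): at every odd `p`, on the Locus
(X11b ∧ (ram) ∧ `p ∤ ∏_ℓ c_ℓ(E)`), THE open input `P2OpenInputOnTreeOddAt W p` ⟺ `BSD(E,p)` given
the twelve published facts of route p2 and — for the direction ⟸ only — the CONTROL IDENTITY
(Castella 2018 Thm. 2.3 / JSW 2017 Thm. 3.3.1 on the constructed `X_ac`, odd form, stated inline as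
the hypothesis `hC`). `Three/ControlIdentityOdd` (x11b3-p9): that very `hC` is a THEOREM — modulo
Kolyvagin and route R1's four CITED cohomological facts (Poitou–Tate ×2, local Euler characteristic,
`cd_p ≤ 2`) — on X11b ∧ (ram) ∧ `p ∤ ∏c` ∧ `LocallyTrivialAt W p` (every bad `ℓ ≠ p`: `E(ℚ_ℓ)[p] = 0`
and `p ∤ c_ℓ(E)`; numeric test `p ∤ c_ℓ(E)·#Ẽ_ns(𝔽_ℓ)` — "no bad `ℓ ≠ p` anomalous for `p`"),
`p2ControlOnTree_odd_of_locallyTrivial`. `Three/StepLAtThree` (x11b3-p1): the team's typed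
STEP-L-at-3 conjecture `Three.StepLAt W ↔ P2OpenInputOnTreeOddAt W 3`. Hence:

* §1 `p2ControlOnTreeAt_of_locallyTrivial` — multr1-p2's `P2ControlOnTreeAt W p` (`p ≥ 5` among its
  antecedents; the hypothesis `hC` of `P2.openInputOnTreeAt_iff_bsdp_of_locus`, gen 18) on the
  sub-population; `p2ControlOnTree_three_of_locallyTrivial` — the `p = 3` row of the control identity.
* §2 **`P2.openInputOnTreeOddAt_iff_bsdp_of_locus_of_locallyTrivial`** — every odd `p`: THE open input
  ⟺ `BSD(E,p)` on X11b ∧ (ram) ∧ `p ∤ ∏c` ∧ locally-trivial from published + cited facts ALONE (no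
  hypothesis of any shape besides the open input itself); `P2.openInputOnTreeOddAt_of_bsdp_of_locallyTrivial`
  — the validation direction `BSD(E,p)` ⟹ open input (every pair of the sub-population with `BSD(E,p)`
  certified per pair — exact `p`-Selmer certificates SEL3X/T-SEL3, Miller's `N < 5000` — satisfies
  THE open input at every Heegner datum the route quantifies over).
* §3 the `p = 3` rows: `P2.openInputOnTreeOddAt_three_iff_bsdp_of_locallyTrivial`; the SEMISTABLE
  numeric form `…_of_semistable_of_not_dvd_of_numeric` ((ram) automatic by Diamond's refined
  level-lowering, `ram_of_semistable_of_irr_of_le_seven`; `LocallyTrivialAt` by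
  `locallyTrivialAt_of_not_dvd`) = CLASS-CLOSURE-PLAN §3.10 (E2)'s 'verbatim-extension' sub-class
  '`3 ‖ N` semistable, `3 ∤ ∏c`, non-anomalous' AT THE ALGEBRAIC HALF; and
  **`Three.stepLAt_iff_bsdp_of_locallyTrivial`**: `Three.StepLAt W ↔ BSDp W 3` there — on this
  decidable sub-population statement discovery (E1) can neither weaken nor strengthen the typed
  target, only find its SOURCE.

What this is NOT: THE open input (IMC≥)∘(BDP) at `3` is untouched — O2 stays OPEN; nothing is
booked; off `LocallyTrivialAt` the local-kernel atom (P11) is still typed (route R1), off `p ∤ ∏c`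
the Tamagawa input (T2′) is; 0 facts minted.

References: [Castella2018] Thm. 2.3 (arXiv:1704.06608 p. 5), Thm. 3.2 (p. 9); [Castella2018Erratum]
(2.4); [JetchevSkinnerWan2017] §2 (p. 6 L9 "p ≥ 3"), Thm. 3.3.1, Prop. 3.2.1, Lemma 3.3.3, §7.4.1–7.4.3
(arXiv:1512.06894 pp. 10–12, 30–31); [Skinner2016PacificMC] Thm. C; [Wuthrich2014] Prop. 21;
[Kolyvagin1990] Thm. A; [MilneADT2006] I 2.8, I 4.10; [GreenbergLNM1716] §3 pp. 74–75; [Miller2011LMS] Def. 1.1.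
-/

noncomputable section

open scoped Classical

open WeierstrassCurve NumberField IsDedekindDomain Field
  Literature.NumberTheory.EllipticCurves Literature.NumberTheory.EllipticCurves.GreenbergSelmer
  Literature.NumberTheory.EllipticCurves.ModularForms Literature.NumberTheory.EllipticCurves.Rank1Residual
  Literature.NumberTheory.EllipticCurves.Rank1Residual.Typed Literature.NumberTheory.EllipticCurves.Wuthrich2014
  Literature.NumberTheory.GaloisRepresentations Literature.NumberTheory.GaloisCohomology
  Summit.BirchSwinnertonDyer.Rank1Residual.X11b.AcSelmer Summit.BirchSwinnertonDyer.Rank1Residual.X11b.LocBridge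

namespace Summit.BirchSwinnertonDyer.Rank1Residual.X11b

/-! ## §1. The control hypothesis of record on the sub-population: `p ≥ 5` form and `p = 3` row -/

section Control

variable (W : WeierstrassCurve ℚ) [W.IsElliptic] [W.IsGloballyMinimal] (p : ℕ) [Fact p.Prime]

/-- **multr1-p2's `P2ControlOnTreeAt W p` itself (`p ≥ 5` among its antecedents) is a THEOREM on
X11b ∧ (ram) ∧ `p ∤ ∏c` ∧ locally-trivial**, modulo Kolyvagin and the four cited cohomological
facts: the hypothesis `hC` of the tightness theorem `P2.openInputOnTreeAt_iff_bsdp_of_locus`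
(`BDPRouteOpenInputTight`, gen 18) is discharged on Locus ∩ `LocallyTrivialAt`. CONDITIONAL on the
named/cited facts; nothing booked. [cite: Castella2018, Thm. 2.3 (arXiv:1704.06608 p. 5)]
[cite: JetchevSkinnerWan2017, Thm. 3.3.1 (arXiv:1512.06894 p. 11)] -/
theorem p2ControlOnTreeAt_of_locallyTrivial
    (hKo : ∀ (N : ℕ) [NeZero N] (W : WeierstrassCurve ℚ) (K : Type) [Field K] [NumberField K],
      kolyvagin N W K)
    (hPT : ∀ (K : Type) [Field K] [NumberField K], poitouTate_selmerStructure_duality K)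
    (hPT2 : ∀ (K : Type) [Field K] [NumberField K], poitouTate_sha_tateDual K)
    (hEP : ∀ (K : Type) [Field K] [NumberField K] (v : HeightOneSpectrum (𝓞 K)),
      localEulerPoincareCharacteristic (v.adicCompletion K))
    (hcd : fieldCdLE_two_of_numberField)
    (hX : ClassX11b W p) (hram : Ram W p) (htam : ¬ p ∣ W.tamagawaProduct)
    (hLT : LocallyTrivialAt W p) : P2ControlOnTreeAt W p := by
  intro N _ K _ _ Dt H ι P hX' _ hs hN hK hodd hpd hμ hHN hLt hP hc hPinf κ hκ γ _ 𝔭 h𝔭 he hf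
  exact p2ControlOnTree_odd_of_locallyTrivial W p hKo hPT hPT2 hEP hcd hX hram htam hLT N K Dt H ι P
    hX' hs hN hK hodd hpd hμ hHN hLt hP hc hPinf κ hκ γ 𝔭 h𝔭 he hf

/-- **The `p = 3` row (team x11b3, O2).** For `E` with `(E,3) ∈` X11b, a (ram) prime at `3`
(`∃ q ‖ N`, `q ≠ 3`, `3 ∤ v_q(Δ_min)`; automatic for semistable `E`, `ram_three_of_semistable_of_irr`),
`3 ∤ ∏_ℓ c_ℓ(E)` and `LocallyTrivialAt W 3` (every bad `ℓ ≠ 3`: `E(ℚ_ℓ)[3] = 0 ∧ 3 ∤ c_ℓ`; numeric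
test `3 ∤ c_ℓ·#Ẽ_ns(𝔽_ℓ)`): the control identity Cas18 Thm. 2.3 / JSW17 Thm. 3.3.1 holds ON THE
TREE'S OBJECTS at every odd-`d_K` Heegner datum route p2 quantifies over — the ∀-data body of
`P2ControlOnTreeAt W 3` without `5 ≤ 3`. So on this sub-population the odd-prime tightness of THE
open input at `3` needs no control hypothesis. CONDITIONAL on Kolyvagin + the four cited
cohomological facts; nothing booked; X11 ∧ `r = 1` at `p = 3` stays CONSTRUCTION-SHAPED / OPEN.
[cite: Castella2018, Thm. 2.3 (arXiv:1704.06608 p. 5)] [cite: JetchevSkinnerWan2017, §2 (p. 6 L9 "p ≥ 3") and Thm. 3.3.1 (arXiv:1512.06894 p. 11)] -/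
theorem p2ControlOnTree_three_of_locallyTrivial [Fact (Nat.Prime 3)]
    (hKo : ∀ (N : ℕ) [NeZero N] (W : WeierstrassCurve ℚ) (K : Type) [Field K] [NumberField K],
      kolyvagin N W K)
    (hPT : ∀ (K : Type) [Field K] [NumberField K], poitouTate_selmerStructure_duality K)
    (hPT2 : ∀ (K : Type) [Field K] [NumberField K], poitouTate_sha_tateDual K)
    (hEP : ∀ (K : Type) [Field K] [NumberField K] (v : HeightOneSpectrum (𝓞 K)),
      localEulerPoincareCharacteristic (v.adicCompletion K))
    (hcd : fieldCdLE_two_of_numberField)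
    (hX : ClassX11b W 3) (hram : Ram W 3) (htam : ¬ 3 ∣ W.tamagawaProduct)
    (hLT : LocallyTrivialAt W 3) :
    ∀ (N : ℕ) [NeZero N] (K : Type) [Field K] [NumberField K]
      (Dt : ModularParametrizationData W N) (H : HeegnerDatum N (NumberField.discr K)) (ι : K →+* ℂ)
      (P : (W.baseChange K).toAffine.Point),
      ClassX11b W 3 → Surj W 3 → W.conductorNorm ℤ = N → IsImaginaryQuadratic K →
      Odd (NumberField.discr K) → ¬ (3 : ℤ) ∣ NumberField.discr K → ¬ 3 ∣ Units.torsionOrder K →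
      SatisfiesHeegnerHypothesis N K →
      (W.quadraticTwist (NumberField.discr K : ℚ)).entireLFunction 1 ≠ 0 →
      WeierstrassCurve.Affine.Point.map ι.toRatAlgHom P = heegnerPointComplex Dt H →
      ¬ (3 : ℤ) ∣ Dt.c → ¬ IsOfFinAddOrder P →
      ∀ (κ : ZpExtension K 3), κ.IsAnticyclotomic →
        ∀ (γ : Field.absoluteGaloisGroup K) [Fact (κ.IsTopGenerator γ)]
          (𝔭 : HeightOneSpectrum (𝓞 K)) (h𝔭 : ((3 : ℕ) : 𝓞 K) ∈ 𝔭.asIdeal)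
          (he : 𝔭.asIdeal.ramificationIdx (𝓞 ℚ) = 1) (hf : 𝔭.asIdeal.inertiaDeg (𝓞 ℚ) = 1),
          ControlOnTreeAt 3 κ 𝔭 γ (embAt K 3 𝔭 h𝔭 he hf) P :=
  p2ControlOnTree_odd_of_locallyTrivial W 3 hKo hPT hPT2 hEP hcd hX hram htam hLT

end Control

/-! ## §2. With the odd-prime tightness (team T3, `Three/OpenInputTight`): THE open input ⟺ `BSD(E,p)`
on Locus ∩ locally-trivial from published + cited facts ALONE -/

section Tight

variable (W : WeierstrassCurve ℚ) [W.IsElliptic] [W.IsGloballyMinimal] (p : ℕ) [Fact p.Prime]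

/-- **THE OPEN INPUT (odd form) ⟺ `BSD(E,p)` on X11b ∧ (ram) ∧ `p ∤ ∏_ℓ c_ℓ(E)` ∧ `LocallyTrivialAt W p`,
EVERY ODD `p`, from published + cited facts ALONE** — the team's tightness theorem
`P2.openInputOnTreeOddAt_iff_bsdp_of_locus` (x11b3-p7) with its control-identity hypothesis `hC`
DISCHARGED by `p2ControlOnTree_odd_of_locallyTrivial` (`Three/ControlIdentityOdd` §5). Inputs: the twelve published facts of
route p2 (Gross–Zagier, Kolyvagin ×2, Skinner 2016 Thm. C, Wuthrich Prop. 21, GZK, modularity ×2,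
Hoffstein–Luo, Mazur, Poitou–Tate sum formula, local Euler characteristic) and route R1's three further
CITED cohomological facts (Poitou–Tate duality for Selmer structures, Poitou–Tate duality of `Ш`,
`cd_p ≤ 2`). Reading: on this decidable sub-population the literature is asked, pair by pair, EXACTLY
`BSD(E,p)`'s worth — no hypothesis of any shape remains besides the open input itself. CONDITIONAL
bookkeeping; nothing booked; X11b stays CONSTRUCTION-SHAPED (the open input is untouched).
[cite: Castella2018, Thm. 2.3 (p. 5), Thm. 3.2 (p. 9)] [cite: Castella2018Erratum, (2.4) (p. 1)]
[cite: JetchevSkinnerWan2017, Thm. 3.3.1, Prop. 3.2.1, Lemma 3.3.3 (pp. 10–12), §7.4.1–7.4.3 (pp. 30–31)]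
[cite: Skinner2016PacificMC, Thm. C (§1) and footnote 1] [cite: Kolyvagin1990, Thm. A]
[cite: MilneADT2006, Ch. I, Thm. 4.10 and Thm. 2.8] [cite: Miller2011LMS, Def. 1.1] -/
theorem P2.openInputOnTreeOddAt_iff_bsdp_of_locus_of_locallyTrivial
    (hGZ : ∀ (N : ℕ) [NeZero N] (W : WeierstrassCurve ℚ) (K : Type) [Field K] [NumberField K],
      gross_zagier N W K)
    (hKo : ∀ (N : ℕ) [NeZero N] (W : WeierstrassCurve ℚ) (K : Type) [Field K] [NumberField K],
      kolyvagin N W K)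
    (hB : ∀ (N : ℕ) [NeZero N] (W : WeierstrassCurve ℚ) (K : Type) [Field K] [NumberField K],
      Kolyvagin1990_padicValNat_card_sha_le N W K)
    (hSk : Skinner2016.thmC_padicValRat_bsd_rank_zero) (hWu : sha_dvd_analyticSha)
    (hGZK : rank_eq_analyticRank_of_analyticRank_le_one) (hmod : hasEntireLFunction_rat)
    (hnf : exists_isNewformOf) (hHL : HoffsteinLuo1997_exists_twist_L_one_ne_zero)
    (hMaz : mazur_not_dvd_maninConstant_of_odd)
    (hPT : ∀ (K : Type) [Field K] [NumberField K], poitouTate_sum_localTatePairing_eq_zero K)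
    (hEP : ∀ (K : Type) [Field K] [NumberField K] (v : HeightOneSpectrum (𝓞 K)),
      localEulerPoincareCharacteristic (v.adicCompletion K))
    -- the three further cited cohomological facts (route R1's currency)
    (hPTs : ∀ (K : Type) [Field K] [NumberField K], poitouTate_selmerStructure_duality K)
    (hPT2 : ∀ (K : Type) [Field K] [NumberField K], poitouTate_sha_tateDual K)
    (hcd : fieldCdLE_two_of_numberField)
    -- the pair: Locus ∩ locally trivial
    (hX : ClassX11b W p) (hram : Ram W p) (htam : ¬ p ∣ W.tamagawaProduct)
    (hLT : LocallyTrivialAt W p) :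
    P2OpenInputOnTreeOddAt W p ↔ BSDp W p :=
  P2.openInputOnTreeOddAt_iff_bsdp_of_locus W p hGZ hKo hB hSk hWu hGZK hmod hnf hHL hMaz hPT hEP
    (p2ControlOnTree_odd_of_locallyTrivial W p hKo hPTs hPT2 hEP hcd hX hram htam hLT) hX hram htam

/-- **`BSD(E,p)` ⟹ THE OPEN INPUT, facts only, on X11b ∧ (ram) ∧ `p ∤ ∏c` ∧ locally-trivial, every odd
`p`** (the validation direction: at every pair of this sub-population where `BSD(E,p)` is certified per
pair — exact `p`-Selmer certificates, Miller's `N < 5000` — THE open input HOLDS at every Heegner datum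
the route quantifies over; nothing beyond the published/cited facts is assumed). x11b3-p7's
`P2.openInputOnTreeOddAt_of_bsdp_of_ram` with `hC` discharged by `Three/ControlIdentityOdd` §5. CONDITIONAL bookkeeping; nothing
booked. [cite: Castella2018, Thm. 2.3 (p. 5), Thm. 3.2 (p. 9), (1.1) (p. 2)]
[cite: JetchevSkinnerWan2017, Thm. 3.3.1 (p. 11), §7.4.1 (pp. 30–31)] [cite: Skinner2016PacificMC, Thm. C (§1) and footnote 1]
[cite: Kolyvagin1990, Thm. A] [cite: Miller2011LMS, Def. 1.1] -/
theorem P2.openInputOnTreeOddAt_of_bsdp_of_locallyTrivial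
    (hGZ : ∀ (N : ℕ) [NeZero N] (W : WeierstrassCurve ℚ) (K : Type) [Field K] [NumberField K],
      gross_zagier N W K)
    (hKo : ∀ (N : ℕ) [NeZero N] (W : WeierstrassCurve ℚ) (K : Type) [Field K] [NumberField K],
      kolyvagin N W K)
    (hSk : Skinner2016.thmC_padicValRat_bsd_rank_zero)
    (hGZK : rank_eq_analyticRank_of_analyticRank_le_one) (hmod : hasEntireLFunction_rat)
    (hEP : ∀ (K : Type) [Field K] [NumberField K] (v : HeightOneSpectrum (𝓞 K)),
      localEulerPoincareCharacteristic (v.adicCompletion K))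
    (hPTs : ∀ (K : Type) [Field K] [NumberField K], poitouTate_selmerStructure_duality K)
    (hPT2 : ∀ (K : Type) [Field K] [NumberField K], poitouTate_sha_tateDual K)
    (hcd : fieldCdLE_two_of_numberField)
    (hX : ClassX11b W p) (hram : Ram W p) (htam : ¬ p ∣ W.tamagawaProduct)
    (hLT : LocallyTrivialAt W p) (hbsd : BSDp W p) : P2OpenInputOnTreeOddAt W p :=
  P2.openInputOnTreeOddAt_of_bsdp_of_ram W p hGZ hKo hSk hGZK hmod
    (p2ControlOnTree_odd_of_locallyTrivial W p hKo hPTs hPT2 hEP hcd hX hram htam hLT) hram hbsd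

end Tight

/-! ## §3. The `p = 3` rows for team x11b3 (O2): facts only, no control hypothesis -/

section ThreeTight

variable (W : WeierstrassCurve ℚ) [W.IsElliptic] [W.IsGloballyMinimal]

/-- **X11b@3 on atom A1 ∩ locally-trivial ((ram), `3 ∤ ∏_ℓ c_ℓ(E)`, and at every bad `ℓ ≠ 3`:
`E(ℚ_ℓ)[3] = 0 ∧ 3 ∤ c_ℓ`) — THE open input at `(E,3)` ⟺ `BSD(E,3)` from published + cited facts
ALONE** (the `p = 3` row of `P2.openInputOnTreeOddAt_iff_bsdp_of_locus_of_locallyTrivial`). NOTHING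
in print or announced supplies the open input at `3`; X11b@3 stays OPEN (RESIDUAL-MAP §I O2); this
only says that on this sub-population the typed input is EXACTLY as strong as `BSD(E,3)`, with no
auxiliary hypothesis left. [cite: Castella2018, Thm. 2.3 (p. 5), Thm. 3.2 (p. 9)]
[cite: JetchevSkinnerWan2017, §2 (p. 6 L9 "p ≥ 3"), Thm. 3.3.1 (p. 11), §7.4.1–7.4.3 (pp. 30–31)]
[cite: Skinner2016PacificMC, Thm. C (§1) and footnote 1] [cite: Wuthrich2014, Prop. 21 (p. 400)] [cite: Miller2011LMS, Def. 1.1] -/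
theorem P2.openInputOnTreeOddAt_three_iff_bsdp_of_locallyTrivial [Fact (Nat.Prime 3)]
    (hGZ : ∀ (N : ℕ) [NeZero N] (W : WeierstrassCurve ℚ) (K : Type) [Field K] [NumberField K],
      gross_zagier N W K)
    (hKo : ∀ (N : ℕ) [NeZero N] (W : WeierstrassCurve ℚ) (K : Type) [Field K] [NumberField K],
      kolyvagin N W K)
    (hB : ∀ (N : ℕ) [NeZero N] (W : WeierstrassCurve ℚ) (K : Type) [Field K] [NumberField K],
      Kolyvagin1990_padicValNat_card_sha_le N W K)
    (hSk : Skinner2016.thmC_padicValRat_bsd_rank_zero) (hWu : sha_dvd_analyticSha)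
    (hGZK : rank_eq_analyticRank_of_analyticRank_le_one) (hmod : hasEntireLFunction_rat)
    (hnf : exists_isNewformOf) (hHL : HoffsteinLuo1997_exists_twist_L_one_ne_zero)
    (hMaz : mazur_not_dvd_maninConstant_of_odd)
    (hPT : ∀ (K : Type) [Field K] [NumberField K], poitouTate_sum_localTatePairing_eq_zero K)
    (hEP : ∀ (K : Type) [Field K] [NumberField K] (v : HeightOneSpectrum (𝓞 K)),
      localEulerPoincareCharacteristic (v.adicCompletion K))
    (hPTs : ∀ (K : Type) [Field K] [NumberField K], poitouTate_selmerStructure_duality K)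
    (hPT2 : ∀ (K : Type) [Field K] [NumberField K], poitouTate_sha_tateDual K)
    (hcd : fieldCdLE_two_of_numberField)
    (hX : ClassX11b W 3) (hram : Ram W 3) (htam : ¬ 3 ∣ W.tamagawaProduct)
    (hLT : LocallyTrivialAt W 3) :
    P2OpenInputOnTreeOddAt W 3 ↔ BSDp W 3 :=
  P2.openInputOnTreeOddAt_iff_bsdp_of_locus_of_locallyTrivial W 3 hGZ hKo hB hSk hWu hGZK hmod hnf
    hHL hMaz hPT hEP hPTs hPT2 hcd hX hram htam hLT

/-- **X11b@3 on a SEMISTABLE curve with `3 ∤ ∏_ℓ c_ℓ(E)` and the NUMERIC non-anomaly test `3 ∤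
c_ℓ(E)·#Ẽ_ns(𝔽_ℓ)` at every bad `ℓ ≠ 3`** (the CLASS-CLOSURE-PLAN §3.10 'verbatim-extension'
sub-class at the ALGEBRAIC half: (ram) is automatic — Diamond's refined level-lowering `hLL`,
`ram_of_semistable_of_irr_of_le_seven` —, `ρ̄_{E,3}` onto, `LocallyTrivialAt W 3` by
`locallyTrivialAt_of_not_dvd`): THE open input at `(E,3)` ⟺ `BSD(E,3)` from published + cited facts
ALONE. CONDITIONAL bookkeeping; nothing booked; X11b@3 stays OPEN.
[cite: Castella2018, Thm. 2.3 (p. 5), Thm. 3.2 (p. 9)] [cite: JetchevSkinnerWan2017, Thm. 3.3.1 (p. 11), §7.4.1–7.4.3 (pp. 30–31)]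
[cite: SilvermanAEC2009, VII.2 Prop. 2.1, VII.3 Prop. 3.1] [cite: GreenbergLNM1716, §3 pp. 74–75] [cite: Miller2011LMS, Def. 1.1] -/
theorem P2.openInputOnTreeOddAt_three_iff_bsdp_of_semistable_of_not_dvd_of_numeric
    [Fact (Nat.Prime 3)]
    (hGZ : ∀ (N : ℕ) [NeZero N] (W : WeierstrassCurve ℚ) (K : Type) [Field K] [NumberField K],
      gross_zagier N W K)
    (hKo : ∀ (N : ℕ) [NeZero N] (W : WeierstrassCurve ℚ) (K : Type) [Field K] [NumberField K],
      kolyvagin N W K)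
    (hB : ∀ (N : ℕ) [NeZero N] (W : WeierstrassCurve ℚ) (K : Type) [Field K] [NumberField K],
      Kolyvagin1990_padicValNat_card_sha_le N W K)
    (hSk : Skinner2016.thmC_padicValRat_bsd_rank_zero) (hWu : sha_dvd_analyticSha)
    (hGZK : rank_eq_analyticRank_of_analyticRank_le_one) (hmod : hasEntireLFunction_rat)
    (hnf : exists_isNewformOf) (hHL : HoffsteinLuo1997_exists_twist_L_one_ne_zero)
    (hMaz : mazur_not_dvd_maninConstant_of_odd)
    (hPT : ∀ (K : Type) [Field K] [NumberField K], poitouTate_sum_localTatePairing_eq_zero K)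
    (hEP : ∀ (K : Type) [Field K] [NumberField K] (v : HeightOneSpectrum (𝓞 K)),
      localEulerPoincareCharacteristic (v.adicCompletion K))
    (hPTs : ∀ (K : Type) [Field K] [NumberField K], poitouTate_selmerStructure_duality K)
    (hPT2 : ∀ (K : Type) [Field K] [NumberField K], poitouTate_sha_tateDual K)
    (hcd : fieldCdLE_two_of_numberField)
    (hLL : Literature.NumberTheory.Automorphic.diamond1995_refinedSerre)
    (hsst : Semistable W) (hX : ClassX11b W 3) (htam : ¬ 3 ∣ W.tamagawaProduct)
    (hnum : ∀ (ℓ : ℕ) [Fact ℓ.Prime], ℓ ∣ W.conductorNorm ℤ → ℓ ≠ 3 →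
      ¬ 3 ∣ (W.baseChange ((ratPlace ℓ).adicCompletion ℚ)).localTamagawaNumber
          ((ratPlace ℓ).adicCompletionIntegers ℚ) * reductionPointCount W ℓ) :
    P2OpenInputOnTreeOddAt W 3 ↔ BSDp W 3 :=
  P2.openInputOnTreeOddAt_three_iff_bsdp_of_locallyTrivial W hGZ hKo hB hSk hWu hGZK hmod hnf hHL
    hMaz hPT hEP hPTs hPT2 hcd hX
    (ram_of_semistable_of_irr_of_le_seven hnf hLL W 3 hX.2.1 (by norm_num) hsst hX.2.2.2) htam
    (locallyTrivialAt_of_not_dvd W 3 hnum)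

/-- **The team's typed STEP-L-at-3 conjecture `Three.StepLAt W` (x11b3-p1, `Three/StepLAtThree`) is
EQUIVALENT to `BSD(E,3)` on X11b@3 ∧ (ram) ∧ `3 ∤ ∏c` ∧ locally-trivial, from published + cited facts
ALONE** (`Three.stepLAt_iff_p2OpenInputOnTreeOddAt` ∘ the previous rows). Reading for CLASS-CLOSURE-PLAN §3.10 (E1):
on this decidable sub-population statement discovery can neither weaken nor strengthen the typed
target — it can only find its SOURCE; and every pair there with `BSD(E,3)` certified per pair is a
pair where `StepLAt` PROVABLY holds. CONDITIONAL bookkeeping; nothing booked; X11b@3 stays OPEN.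
[cite: Castella2018, Thm. 2.3 (p. 5), Thm. 3.2 (p. 9)] [cite: JetchevSkinnerWan2017, Thm. 3.3.1 (p. 11), §7.4.1–7.4.3 (pp. 30–31)]
[cite: Skinner2016PacificMC, Thm. C (§1) and footnote 1] [cite: Miller2011LMS, Def. 1.1] -/
theorem Three.stepLAt_iff_bsdp_of_locallyTrivial
    (hGZ : ∀ (N : ℕ) [NeZero N] (W : WeierstrassCurve ℚ) (K : Type) [Field K] [NumberField K],
      gross_zagier N W K)
    (hKo : ∀ (N : ℕ) [NeZero N] (W : WeierstrassCurve ℚ) (K : Type) [Field K] [NumberField K],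
      kolyvagin N W K)
    (hB : ∀ (N : ℕ) [NeZero N] (W : WeierstrassCurve ℚ) (K : Type) [Field K] [NumberField K],
      Kolyvagin1990_padicValNat_card_sha_le N W K)
    (hSk : Skinner2016.thmC_padicValRat_bsd_rank_zero) (hWu : sha_dvd_analyticSha)
    (hGZK : rank_eq_analyticRank_of_analyticRank_le_one) (hmod : hasEntireLFunction_rat)
    (hnf : exists_isNewformOf) (hHL : HoffsteinLuo1997_exists_twist_L_one_ne_zero)
    (hMaz : mazur_not_dvd_maninConstant_of_odd)
    (hPT : ∀ (K : Type) [Field K] [NumberField K], poitouTate_sum_localTatePairing_eq_zero K)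
    (hEP : ∀ (K : Type) [Field K] [NumberField K] (v : HeightOneSpectrum (𝓞 K)),
      localEulerPoincareCharacteristic (v.adicCompletion K))
    (hPTs : ∀ (K : Type) [Field K] [NumberField K], poitouTate_selmerStructure_duality K)
    (hPT2 : ∀ (K : Type) [Field K] [NumberField K], poitouTate_sha_tateDual K)
    (hcd : fieldCdLE_two_of_numberField)
    (hX : ClassX11b W 3) (hram : Ram W 3) (htam : ¬ 3 ∣ W.tamagawaProduct)
    (hLT : LocallyTrivialAt W 3) :
    Three.StepLAt W ↔ BSDp W 3 :=
  Three.stepLAt_iff_p2OpenInputOnTreeOddAt.trans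
    (P2.openInputOnTreeOddAt_three_iff_bsdp_of_locallyTrivial W hGZ hKo hB hSk hWu hGZK hmod hnf hHL
      hMaz hPT hEP hPTs hPT2 hcd hX hram htam hLT)

end ThreeTight

end Summit.BirchSwinnertonDyer.Rank1Residual.X11b

end
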